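import Literature.AlgebraicGeometry.ModuliOfAbelianVarieties.SiegelCMSpecialPointUnique
import Mathlib.LinearAlgebra.Eigenspace.Charpoly
import Mathlib.LinearAlgebra.Charpoly.ToMatrix
import HarnessLib

/-!
# The CM types of a special pair are read off the complex structure
# ([Deligne 1971] 4.18; [Milne ISV] Ex. 12.4 (b): `Φ` is determined by `h_Φ`)

Topic `AlgebraicGeometry/ModuliOfAbelianVarieties`; namespace
`Literature.AlgebraicGeometry.ModuliOfAbelianVarieties.CMStructure`.  THEOREMS ONLY (no definition, no named fact, no
instance, no `sorry`; net Literature debt **0**).  Sequel of ★ (σ4)-D `SiegelCanonicalModel` (`CMStructure`, `IsSpecial`) and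
the CONVERSE companion of ★ R60-10 `SiegelCMSpecialPointUnique` (`IsSpecial.eq`: the special point is determined by the CM
types).  Cell hodgecm-mathlib (D-0151), banked GENERIC leaf R60-23 toward fan-B row I-7 (#60) `SiegelS1` (director g6 RULING
s86 (2)(b); table `ROAD60-TABLE.md`, A-p05 TABLE v1.5 «(R60-23) the converse of R60-10»).

WHAT IS PROVED.  Let `c` be a CM structure of type `δ` ([Deligne1971TravauxShimura] 4.18): an injective `ℚ`-algebra map
`act : F = ∏ᵢ Kᵢ → End_ℚ(ℚ^{2g})`, `Kᵢ` CM number fields; write `V_{i,ρ} = {v ∈ ℂ^{2g} | act(ιᵢ x)·v = ρ(x)·v for all x ∈ Kᵢ}`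
for the common eigenline of the factor `Kᵢ` with character `ρ : Kᵢ → ℂ` (`ιᵢ = Pi.single i`).
* §1 `minpoly_dvd_charpoly_actMatrix_single` — for `x ∈ Kᵢ` the minimal polynomial of `x` over `ℚ` divides the characteristic
  polynomial of `act(ιᵢ x)` (Cayley–Hamilton + injectivity of `act` + evaluation at the `i`-th factor); hence
  `hasEigenvalue_toLin'_actMatrix_single` — EVERY conjugate `ρ(x)` is an eigenvalue of `act(ιᵢ x) ⊗ ℂ`
  (Mathlib `Module.End.hasEigenvalue_iff_isRoot_charpoly`, `Matrix.charpoly_map`).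
* §2 `exists_ne_zero_forall_mulVec_eq_smul` / `eigenline_ne_bot` — **EVERY EIGENLINE IS NON-ZERO**: `V_{i,ρ} ≠ 0` for every
  factor `i` and every complex embedding `ρ` of `Kᵢ` ([Shimura1998] §5.1 Lemma 1: a faithful representation of the CM algebra
  `F` over `ℂ` contains every character `x ↦ ρ(xᵢ)`).  Proof: a primitive element `x₀` of `Kᵢ/ℚ` gives an eigenvector `u ≠ 0`
  of `act(ιᵢ x₀) ⊗ ℂ` for `ρ(x₀)` (§1); `ρ(x₀) ≠ 0` forces `eᵢ u = u` for the idempotent `eᵢ = act(ιᵢ 1)`, and the eigenvector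
  equation propagates from `x₀` to `ℚ[x₀] = Kᵢ` (`Algebra.adjoin_induction`).  No use of `[F : ℚ] = 2g`.
* §3 HEAD `IsSpecial.mem_iff_mem` / **`IsSpecial.cmType_eq`** — if `(c, J)` is special for the CM types `Φ` AND for `Φ′`
  (`c.IsSpecial J Φ`, `c.IsSpecial J Φ′`) then `Φ = Φ′`: on a non-zero `v ∈ V_{i,ρ}` (§2) the operator `J ⊗ ℂ` is `+i` if
  `ρ ∈ Φᵢ` and `−i` if `ρ ∉ Φᵢ` (the `IsSpecial` clause), and `i·v = −i·v` forces `v = 0`.  [Milne2005ShimuraVarieties]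
  Ex. 12.4 (b): «`h_Φ(z)` acts on `V_φ` as multiplication by `φ(z)` for `φ ∈ Φ`» — so `Φ = {φ | h_Φ = +i on V_φ}` is READ OFF
  `J = h_Φ(i)`.  Together with ★ R60-10 `IsSpecial.eq`: over a fixed CM structure `c`, special pairs `(J, Φ)` are in bijection
  with either coordinate (strength reading for the `∀ J ∀ Φ, IsSpecial J Φ →` quantifier of ★ `SiegelRationalModel.IsCanonical`,
  the cell's row #60).
Nothing printed is asserted.  HC_CM is proved only modulo the 7 printed citations until rung 0 closes.

## References
* [Deligne1971TravauxShimura] P. Deligne, *Travaux de Shimura*, Sém. Bourbaki 389 (1971), 4.18 p. 150.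
* [Milne2005ShimuraVarieties] J. S. Milne, *Introduction to Shimura varieties* (2005), Ex. 12.4 (b) p. 112, §14 p. 125.
* [MilneCM2006] J. S. Milne, *Complex Multiplication* (2006), Ch. I §1 (CM algebras, `E ⊗ ℂ ≅ ∏_φ ℂ`).
* [Shimura1998] G. Shimura, *Abelian Varieties with Complex Multiplication and Modular Functions* (1998), §5.1 Lemma 1.
-/

set_option autoImplicit false

noncomputable section

open Matrix NumberField Polynomial
open scoped IntermediateField

namespace Literature.AlgebraicGeometry.ModuliOfAbelianVarieties

namespace CMStructure

open Literature.AlgebraicGeometry.Motives (CMType)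

variable {g : ℕ} {δ : Fin g → ℕ} {ι : Type} [Fintype ι] [DecidableEq ι] {K : ι → Type} [∀ i, Field (K i)]
  [∀ i, NumberField (K i)] [∀ i, IsCMField (K i)] (c : CMStructure g δ ι K)

/-! ### §1. Every conjugate `ρ(x)` is an eigenvalue of `act(ιᵢ x) ⊗ ℂ` -/

omit [Fintype ι] [DecidableEq ι] in
/-- A primitive element of a CM field over `ℚ` is non-zero (`ℚ(0) = ℚ ≠ K` because complex conjugation is a
non-trivial automorphism).  (Copy of the private lemma of ★ `SiegelCMSpecialPointUnique`.) [cite: Shimura1998, §5.1 Lemma 1] -/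
private theorem primitive_ne_zero' (i : ι) {x₀ : K i} (hx₀ : ℚ⟮x₀⟯ = ⊤) : x₀ ≠ 0 := by
  rintro rfl
  rw [IntermediateField.adjoin_zero] at hx₀
  apply IsCMField.complexConj_ne_one (K i)
  ext x
  have hx : x ∈ (⊥ : IntermediateField ℚ (K i)) := by rw [hx₀]; exact IntermediateField.mem_top
  obtain ⟨q, rfl⟩ := IntermediateField.mem_bot.mp hx
  change IsCMField.complexConj (K i) (algebraMap ℚ (K i) q) = algebraMap ℚ (K i) q
  rw [eq_ratCast, map_ratCast]

/-- **Cayley–Hamilton on the faithful `F`-module `ℚ^{2g}`**: for `x ∈ Kᵢ`, the minimal polynomial of `x` over `ℚ` divides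
the characteristic polynomial of `act(ιᵢ x)` — the characteristic polynomial kills `act(ιᵢ x)`, hence (`act` being an
injective `ℚ`-algebra map) kills `ιᵢ x ∈ F = ∏ Kⱼ`, hence its `i`-th component `x`.
[cite: Shimura1998, §5.1 Lemma 1] [cite: Deligne1971TravauxShimura, 4.18 p. 150] -/
theorem minpoly_dvd_charpoly_actMatrix_single (i : ι) (x : K i) :
    minpoly ℚ x ∣ (c.actMatrix (Pi.single i x)).charpoly := by
  classical
  -- `actMatrix` as a `ℚ`-algebra homomorphism `φ : F → M_{2g}(ℚ)`
  let φ : (Π j, K j) →ₐ[ℚ] Matrix (Fin g ⊕ Fin g) (Fin g ⊕ Fin g) ℚ :=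
    (LinearMap.toMatrixAlgEquiv' (R := ℚ) (n := Fin g ⊕ Fin g)).toAlgHom.comp c.act
  have hφ : ∀ z, φ z = c.actMatrix z := fun z => rfl
  have hφinj : Function.Injective φ := fun a b hab =>
    c.act_injective ((LinearMap.toMatrixAlgEquiv' (R := ℚ) (n := Fin g ⊕ Fin g)).injective hab)
  set y : Π j, K j := Pi.single i x with hy
  set p : ℚ[X] := (c.actMatrix y).charpoly with hp
  -- `p(act(ιᵢ x)) = 0` (Cayley–Hamilton), so `p(ιᵢ x) = 0` in `F`
  have h1 : φ (aeval y p) = 0 := by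
    rw [← Polynomial.aeval_algHom_apply φ y p, hφ, hp]
    exact Matrix.aeval_self_charpoly _
  have h2 : aeval y p = 0 := hφinj (by rw [h1, map_zero])
  -- read the `i`-th component: `p(x) = 0`
  have h3 : aeval x p = 0 := by
    have hj : (aeval y p) i = aeval (y i) p := by
      rw [← Pi.evalAlgHom_apply ℚ K i (aeval y p), ← Polynomial.aeval_algHom_apply]; rfl
    rw [show x = y i by rw [hy, Pi.single_eq_same], ← hj, h2, Pi.zero_apply]
  exact minpoly.dvd ℚ x h3

/-- **Every conjugate is an eigenvalue**: for `x ∈ Kᵢ` and a complex embedding `ρ : Kᵢ → ℂ`, `ρ(x)` is an eigenvalue of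
the complexified operator `act(ιᵢ x) ⊗ ℂ` on `ℂ^{2g}` (the eigenvalues are the complex roots of the rational characteristic
polynomial, which the minimal polynomial of `x` divides; `ρ(x)` is a root of the latter).
[cite: Shimura1998, §5.1 Lemma 1] [cite: MilneCM2006, Ch. I §1] -/
theorem hasEigenvalue_toLin'_actMatrix_single (i : ι) (ρ : K i →+* ℂ) (x : K i) :
    Module.End.HasEigenvalue (Matrix.toLin' ((c.actMatrix (Pi.single i x)).map (algebraMap ℚ ℂ))) (ρ x) := by
  classical
  rw [Module.End.hasEigenvalue_iff_isRoot_charpoly, Matrix.charpoly_toLin', Matrix.charpoly_map]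
  refine Polynomial.IsRoot.dvd ?_ (Polynomial.map_dvd (algebraMap ℚ ℂ) (c.minpoly_dvd_charpoly_actMatrix_single i x))
  rw [Polynomial.IsRoot, Polynomial.eval_map, ← Polynomial.aeval_def,
    show ρ x = ρ.toRatAlgHom x from rfl, Polynomial.aeval_algHom_apply ρ.toRatAlgHom x (minpoly ℚ x), minpoly.aeval,
    map_zero]

/-! ### §2. Every eigenline `V_{i,ρ}` is non-zero -/

/-- **EVERY EIGENLINE IS NON-ZERO** ([Shimura1998] §5.1 Lemma 1; [MilneCM2006] Ch. I §1: `Kᵢ ⊗_ℚ ℂ ≅ ∏_ρ ℂ` and `F` acts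
faithfully): for every factor `i` and every complex embedding `ρ : Kᵢ → ℂ` there is a non-zero common eigenvector
`v ∈ ℂ^{2g}` of `Kᵢ` with character `ρ` — `act(ιᵢ x)·v = ρ(x)·v` for all `x ∈ Kᵢ`.  Proof: a primitive element `x₀` of `Kᵢ/ℚ`
(Mathlib `Field.exists_primitive_element`), an eigenvector `u ≠ 0` of `act(ιᵢ x₀) ⊗ ℂ` for `ρ(x₀)` (§1); since `ρ(x₀) ≠ 0` and
`act(ιᵢ 1)·act(ιᵢ x₀) = act(ιᵢ x₀)` the idempotent `eᵢ = act(ιᵢ 1)` fixes `u`; the eigenvector equation then holds on the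
`ℚ`-subalgebra generated by `x₀`, which is `Kᵢ`. [cite: Shimura1998, §5.1 Lemma 1] [cite: MilneCM2006, Ch. I §1]
[cite: Deligne1971TravauxShimura, 4.18 p. 150] -/
theorem exists_ne_zero_forall_mulVec_eq_smul (i : ι) (ρ : K i →+* ℂ) :
    ∃ v : Fin g ⊕ Fin g → ℂ, v ≠ 0 ∧
      ∀ x : K i, (c.actMatrix (Pi.single i x)).map (algebraMap ℚ ℂ) *ᵥ v = ρ x • v := by
  classical
  -- the complexified action as a `ℚ`-algebra homomorphism `A : F → M_{2g}(ℂ)`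
  let A : (Π j, K j) →ₐ[ℚ] Matrix (Fin g ⊕ Fin g) (Fin g ⊕ Fin g) ℂ :=
    ((Algebra.ofId ℚ ℂ).mapMatrix.comp
        (LinearMap.toMatrixAlgEquiv' (R := ℚ) (n := Fin g ⊕ Fin g)).toAlgHom).comp c.act
  have hA : ∀ z, A z = (c.actMatrix z).map (algebraMap ℚ ℂ) := fun z => rfl
  simp only [← hA]
  -- a non-zero primitive element `x₀` of `Kᵢ/ℚ` and an eigenvector `u` of `act(ιᵢ x₀)` for `ρ x₀`
  obtain ⟨x₀, hx₀⟩ := Field.exists_primitive_element ℚ (K i)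
  have hx₀0 : x₀ ≠ 0 := primitive_ne_zero' i hx₀
  have hint : IsIntegral ℚ x₀ := Algebra.IsIntegral.isIntegral x₀
  obtain ⟨u, hu⟩ := (c.hasEigenvalue_toLin'_actMatrix_single i ρ x₀).exists_hasEigenvector
  have hu0 : u ≠ 0 := hu.2
  have hTu : A (Pi.single i x₀) *ᵥ u = ρ x₀ • u := by
    rw [hA, ← Matrix.toLin'_apply]; exact hu.apply_eq_smul
  -- `eᵢ u = u`
  have hμ0 : ρ x₀ ≠ 0 := (map_ne_zero ρ).mpr hx₀0
  have heu : A (Pi.single i 1) *ᵥ u = u := by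
    have h1 : A (Pi.single i 1) * A (Pi.single i x₀) = A (Pi.single i x₀) := by
      rw [← map_mul, ← Pi.single_mul, one_mul]
    have h2 : ρ x₀ • (A (Pi.single i 1) *ᵥ u) = ρ x₀ • u := by
      rw [← Matrix.mulVec_smul, ← hTu, Matrix.mulVec_mulVec, h1]
    exact smul_right_injective _ hμ0 h2
  refine ⟨u, hu0, ?_⟩
  -- propagate the eigenvector equation from `x₀` to `ℚ[x₀] = Kᵢ`
  have htop : Algebra.adjoin ℚ {x₀} = ⊤ := by
    rw [← IntermediateField.adjoin_simple_toSubalgebra_of_isAlgebraic hint.isAlgebraic, hx₀, IntermediateField.top_toSubalgebra]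
  intro x
  have hx : x ∈ Algebra.adjoin ℚ {x₀} := by rw [htop]; exact Algebra.mem_top
  induction hx using Algebra.adjoin_induction with
  | mem z hz =>
    rw [Set.mem_singleton_iff] at hz
    subst hz
    exact hTu
  | algebraMap r =>
    have hs : Pi.single (M := K) i (algebraMap ℚ (K i) r) = algebraMap ℚ (Π j, K j) r * Pi.single i 1 := by
      funext j
      rw [Pi.mul_apply, Pi.algebraMap_apply]
      by_cases hji : j = i
      · subst hji; rw [Pi.single_eq_same, Pi.single_eq_same, mul_one]
      · rw [Pi.single_eq_of_ne hji, Pi.single_eq_of_ne hji, mul_zero]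
    have hρ : ρ (algebraMap ℚ (K i) r) = algebraMap ℚ ℂ r := by
      rw [← RingHom.comp_apply, eq_ratCast, eq_ratCast]
    rw [hs, map_mul, AlgHom.commutes, IsScalarTower.algebraMap_apply ℚ ℂ (Matrix (Fin g ⊕ Fin g) (Fin g ⊕ Fin g) ℂ),
      Algebra.algebraMap_eq_smul_one, smul_one_mul, Matrix.smul_mulVec, heu, hρ]
  | add x y _ _ hx hy =>
    rw [Pi.single_add, map_add, Matrix.add_mulVec, hx, hy, map_add, add_smul]
  | mul x y _ _ hx hy =>
    rw [Pi.single_mul, map_mul, ← Matrix.mulVec_mulVec, hy, Matrix.mulVec_smul, hx, map_mul, smul_smul, mul_comm]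

/-- The same, phrased on the eigenline `V_{i,ρ} = ⋂_{x ∈ Kᵢ} Eig(act(ιᵢ x) ⊗ ℂ, ρ(x))` of ★ `iSup_eigenline_eq_top`:
`V_{i,ρ} ≠ ⊥`. [cite: Shimura1998, §5.1 Lemma 1] [cite: MilneCM2006, Ch. I §1] -/
theorem eigenline_ne_bot (i : ι) (ρ : K i →+* ℂ) :
    (⨅ x : K i, Module.End.eigenspace (Matrix.toLin' ((c.actMatrix (Pi.single i x)).map (algebraMap ℚ ℂ))) (ρ x)) ≠ ⊥ := by
  obtain ⟨v, hv0, hv⟩ := c.exists_ne_zero_forall_mulVec_eq_smul i ρ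
  rw [Submodule.ne_bot_iff]
  refine ⟨v, ?_, hv0⟩
  rw [Submodule.mem_iInf]
  intro x
  rw [Module.End.mem_eigenspace_iff, Matrix.toLin'_apply]
  exact hv x

/-! ### §3. The CM types are determined by the complex structure -/

variable {c}

/-- **Membership in the CM type is read off `J`**: if `(c, J)` is special for `Φ` and for `Φ′`, then for every factor `i` and every
embedding `ρ : Kᵢ → ℂ`, `ρ ∈ Φᵢ ↔ ρ ∈ Φ′ᵢ` — test on a non-zero `v ∈ V_{i,ρ}` (§2): `J ⊗ ℂ` acts on it by `+i` iff `ρ` is in the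
type and by `−i` iff it is not, and `i·v = −i·v` forces `v = 0`. [cite: Milne2005ShimuraVarieties, Ex. 12.4 (b) p. 112]
[cite: Deligne1971TravauxShimura, 4.18 p. 150] -/
theorem IsSpecial.mem_iff_mem {J : C0pm δ} {Φ Φ' : ∀ i, CMType (K i)} (h : c.IsSpecial J Φ) (h' : c.IsSpecial J Φ')
    (i : ι) (ρ : K i →+* ℂ) : ρ ∈ (Φ i).1 ↔ ρ ∈ (Φ' i).1 := by
  obtain ⟨v, hv0, hv⟩ := c.exists_ne_zero_forall_mulVec_eq_smul i ρ
  have h1 := h.2 i ρ v hv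
  have h2 := h'.2 i ρ v hv
  -- `i·v = −i·v` is impossible for `v ≠ 0`
  have key : Complex.I • v ≠ (-Complex.I) • v := by
    intro hIv
    apply hv0
    have h3 : (Complex.I - (-Complex.I)) • v = 0 := by rw [sub_smul, hIv, sub_self]
    have hI : Complex.I - (-Complex.I) ≠ 0 := by
      rw [sub_neg_eq_add, ← two_mul]
      exact mul_ne_zero two_ne_zero Complex.I_ne_zero
    exact (smul_eq_zero.mp h3).resolve_left hI
  constructor
  · intro hρ
    by_contra hρ'
    exact key ((h1.1 hρ).symm.trans (h2.2 hρ'))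
  · intro hρ'
    by_contra hρ
    exact key ((h2.1 hρ').symm.trans (h1.2 hρ))

/-- **HEAD — THE CM TYPES ARE DETERMINED BY THE COMPLEX STRUCTURE** ([Milne2005ShimuraVarieties] Ex. 12.4 (b): the type `Φ`
is the set of `φ` with `h_Φ = +i` on `V_φ`; [Deligne1971TravauxShimura] 4.18): two special pairs `(c, J, Φ)`, `(c, J, Φ′)` with
the SAME complex structure over the same CM structure have the same CM types, `Φ = Φ′`.  Converse companion of ★
`IsSpecial.eq` (same types ⇒ same `J`). [cite: Milne2005ShimuraVarieties, Ex. 12.4 (b) p. 112]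
[cite: Deligne1971TravauxShimura, 4.18 p. 150] -/
theorem IsSpecial.cmType_eq {J : C0pm δ} {Φ Φ' : ∀ i, CMType (K i)} (h : c.IsSpecial J Φ) (h' : c.IsSpecial J Φ') :
    Φ = Φ' := by
  funext i
  apply Subtype.ext
  ext ρ
  exact h.mem_iff_mem h' i ρ

/-- **Special pairs over `c`: either coordinate determines the other** — for special pairs `(J, Φ)` and `(J′, Φ′)` over the
same CM structure, `J = J′ ↔ Φ = Φ′` (★ R60-10 `IsSpecial.eq` and `IsSpecial.cmType_eq`).
[cite: Milne2005ShimuraVarieties, Ex. 12.4 (b) p. 112] [cite: Deligne1971TravauxShimura, 4.18 p. 150] -/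
theorem IsSpecial.eq_iff_cmType_eq {J J' : C0pm δ} {Φ Φ' : ∀ i, CMType (K i)} (h : c.IsSpecial J Φ)
    (h' : c.IsSpecial J' Φ') : J = J' ↔ Φ = Φ' := by
  constructor
  · rintro rfl
    exact h.cmType_eq h'
  · rintro rfl
    exact h.eq h'

end CMStructure

end Literature.AlgebraicGeometry.ModuliOfAbelianVarieties

end
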